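import Mathlib
import Summits.NavierStokesRegularity.NavierStokesRegularity.Theorems.DssFarFieldSlavingBlowupTypeIDssProfileSimilarityEnstrophyTools
import Summits.NavierStokesRegularity.NavierStokesRegularity.Theorems.DssFarFieldSlavingBlowupTypeIDssProfileSimilarityEnstrophyIdentity
import Summits.NavierStokesRegularity.NavierStokesRegularity.Theorems.DssFarFieldSlavingBlowupTypeIDssProfileGaussianGapIdentities
import Literature.Analysis.FluidPDE.Caccioppoli
import Literature.Analysis.FluidPDE.ConstantinDirectionDissipationCalculus
import HarnessLib

/-!
# Similarity enstrophy: the T38 core — a Hardy-subcritical stretching bound forces triviality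
  (pub-ns-dss theory T38-SCOPE (S4) core; route `DssFarFieldSlaving`, crux `BlowupTypeIDssProfile`,
  stmt-NavierStokesRegularity-0155 — SUPPORT, label-free helper; typer seat g6, 2026-08-23)

HONEST FRAMING. Label-free analysis helper for the T38-SCOPE plan of the cell's theory seat (S3 → S2 → S1 → S4;
LIOUVILLE-SIDE l.177): a Liouville-type implication for a HYPOTHETICAL object (the similarity vorticity of a KNSS-gauge
Type-I ancient mild field) under the NAMED space–time decay hypothesis (D) at orders 1, 2, 3 and a NAMED pointwise
threshold hypothesis; neither is derived from Type-I membership here and nothing asserts that either holds for a given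
field. No census word is set by this file (the label-bearing physical / class statements live in the companion file
`…SimilarityEnstrophyHardyThreshold`); nothing numeric; nothing here bears on Navier–Stokes regularity or blow-up. Idea
credit for the Hardy-weighted stretching threshold: the OPEN item `StretchingWellBinding.DssProfileBinding` (stmt-1578),
not addressed here.

CONTENTS. `frobeniusNormSq_fderiv_eq_sum_norm_fderiv_coord_sq` (`|DΩ|²_F = Σᵢ ‖∇Ωᵢ‖²`, linking the dissipation of
`similarityEnstrophy_hasDerivAt` with the vector Hardy inequality of the Tools file), `hardy_sq_lintegral_sub_le_of_decay_vec`
(vector Hardy about an arbitrary centre), `integral_stretching_le_integral_frobeniusNormSq` (under the pointwise bound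
`⟪Ω, DU Ω⟫ ‖y − y₀‖² ≤ ¼‖Ω‖²`: `∫⟪Ω, DU Ω⟫ ≤ ∫|∇Ω|²_F`, constant `4 · ¼ = 1`), and the assembled
**`eq_zero_of_hardySubcriticalStretching`**: (D) at `k = 1, 2, 3` + the pointwise bound at every `s` (one centre `y₀(s)`
per `s`) ⇒ `V ≡ 0` on `t < 0` (Hardy ⇒ `Str ≤ ∫|∇Ω|²_F` ⇒ `Z' ≤ −½Z` by the identity of file 4/4 ⇒ `Z ≡ 0` by the
backward ODE lemma of the Tools file ⇒ `curl U ≡ 0` ⇒ a curl-free divergence-free Type-I field vanishes).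
[this file; theory T38-SCOPE (S4) core, (α) theory g9 l.1436]
-/

noncomputable section

set_option linter.dupNamespace false

namespace Summit.NavierStokesRegularity.NavierStokesRegularity.Theorems.SimilarityEnstrophy

open MeasureTheory Set Filter Topology Module Metric InnerProductSpace Function
open scoped RealInnerProductSpace Laplacian ContDiff ENNReal
open Literature.Analysis Literature.Analysis.FluidPDE Literature.Analysis.Calculus
open Summit.NavierStokesRegularity.NavierStokesRegularity.Theorems.GaussianGap
open Summit.NavierStokesRegularity.NavierStokesRegularity.Theorems.PlanarEnergyAPriori

variable {M : ℝ} {V : ℝ → EuclideanSpace ℝ (Fin 3) → EuclideanSpace ℝ (Fin 3)}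

/-- **The Frobenius norm of the derivative is the sum of the squared gradients of the components**:
`|DΩ(y)|²_F = Σᵢ ‖D(Ωᵢ)(y)‖²` on `ℝ³` (transpose the double sum `Σⱼ Σᵢ (∂ⱼΩᵢ)²`; `‖ℓ‖² = Σⱼ ℓ(eⱼ)²`
for a functional). Links the dissipation of `similarityEnstrophy_hasDerivAt` (tree `frobeniusNormSq`)
with the componentwise right-hand side of the vector Hardy inequality. [folklore] -/
theorem frobeniusNormSq_fderiv_eq_sum_norm_fderiv_coord_sq
    {Ω : EuclideanSpace ℝ (Fin 3) → EuclideanSpace ℝ (Fin 3)} {y : EuclideanSpace ℝ (Fin 3)}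
    (hΩ : DifferentiableAt ℝ Ω y) :
    frobeniusNormSq (fderiv ℝ Ω y) = ∑ i, ‖fderiv ℝ (fun z => Ω z i) y‖ ^ 2 := by
  rw [frobeniusNormSq_eq_sum_sq_coord, Finset.sum_comm]
  refine Finset.sum_congr rfl fun i _ => ?_
  rw [Caccioppoli.sq_norm_dual_eq_sum]
  refine Finset.sum_congr rfl fun j _ => ?_
  rw [fderiv_coord_apply hΩ i, EuclideanSpace.basisFun_apply]

/-- **Hardy for vector fields about an arbitrary centre** (componentwise from the scalar centred
form, as in `hardy_sq_lintegral_le_of_decay_vec`). [folklore] -/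
theorem hardy_sq_lintegral_sub_le_of_decay_vec
    {Ω : EuclideanSpace ℝ (Fin 3) → EuclideanSpace ℝ (Fin 3)} (hΩ : ContDiff ℝ 1 Ω)
    (y₀ : EuclideanSpace ℝ (Fin 3)) {R₁ C₀ : ℝ} (hR₁ : 0 < R₁)
    (hdec : ∀ y : EuclideanSpace ℝ (Fin 3), R₁ < ‖y - y₀‖ → ‖y - y₀‖ * ‖Ω y‖ ≤ C₀) :
    ∫⁻ y, ENNReal.ofReal (‖Ω y‖ ^ 2 / ‖y - y₀‖ ^ 2) ≤
      4 * ∑ i, ∫⁻ y, ENNReal.ofReal (‖fderiv ℝ (fun z => Ω z i) y‖ ^ 2) := by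
  have hE : finrank ℝ (EuclideanSpace ℝ (Fin 3)) = 3 := finrank_euclideanSpace_fin
  have hci : ∀ i : Fin 3, ContDiff ℝ 1 (fun z => Ω z i) := fun i => contDiff_euclidean.1 hΩ i
  have hdeci : ∀ i : Fin 3, ∀ y : EuclideanSpace ℝ (Fin 3), R₁ < ‖y - y₀‖ →
      ‖y - y₀‖ * |Ω y i| ≤ C₀ := by
    intro i y hy
    have h1 : |Ω y i| ≤ ‖Ω y‖ := by
      rw [← Real.norm_eq_abs]; exact PiLp.norm_apply_le (Ω y) i
    exact (mul_le_mul_of_nonneg_left h1 (norm_nonneg _)).trans (hdec y hy)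
  have hcomp : ∀ i : Fin 3, ∫⁻ y, ENNReal.ofReal ((Ω y i) ^ 2 / ‖y - y₀‖ ^ 2) ≤
      4 * ∫⁻ y, ENNReal.ofReal (‖fderiv ℝ (fun z => Ω z i) y‖ ^ 2) := fun i =>
    hardy_sq_lintegral_sub_le_of_decay hE (hci i) y₀ hR₁ (hdeci i)
  have hsplit : ∀ y : EuclideanSpace ℝ (Fin 3), ENNReal.ofReal (‖Ω y‖ ^ 2 / ‖y - y₀‖ ^ 2) =
      ∑ i, ENNReal.ofReal ((Ω y i) ^ 2 / ‖y - y₀‖ ^ 2) := by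
    intro y
    rw [EuclideanSpace.norm_sq_eq, ← ENNReal.ofReal_sum_of_nonneg (fun i _ => by positivity),
      Finset.sum_div]
    simp only [Real.norm_eq_abs, sq_abs]
  have hmeas : ∀ i : Fin 3, Measurable fun y : EuclideanSpace ℝ (Fin 3) =>
      ENNReal.ofReal ((Ω y i) ^ 2 / ‖y - y₀‖ ^ 2) := fun i =>
    (((hci i).continuous.measurable.pow_const 2).div
      ((continuous_norm.comp (continuous_id.sub continuous_const)).measurable.pow_const
        2)).ennreal_ofReal
  calc ∫⁻ y, ENNReal.ofReal (‖Ω y‖ ^ 2 / ‖y - y₀‖ ^ 2)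
      = ∫⁻ y, ∑ i, ENNReal.ofReal ((Ω y i) ^ 2 / ‖y - y₀‖ ^ 2) := lintegral_congr fun y => hsplit y
    _ = ∑ i, ∫⁻ y, ENNReal.ofReal ((Ω y i) ^ 2 / ‖y - y₀‖ ^ 2) :=
        lintegral_finsetSum _ fun i _ => hmeas i
    _ ≤ ∑ i, 4 * ∫⁻ y, ENNReal.ofReal (‖fderiv ℝ (fun z => Ω z i) y‖ ^ 2) :=
        Finset.sum_le_sum fun i _ => hcomp i
    _ = 4 * ∑ i, ∫⁻ y, ENNReal.ofReal (‖fderiv ℝ (fun z => Ω z i) y‖ ^ 2) := by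
        rw [Finset.mul_sum]

/-- **Stretching under a Hardy-subcritical pointwise bound is dominated by the dissipation.** If
`⟪Ω, DU Ω⟫(y) ‖y − y₀‖² ≤ ¼ ‖Ω(y)‖²` for all `y` (one centre `y₀`), then
`∫⟪Ω, DU Ω⟫ ≤ ∫ |∇Ω|²_F` (centred vector Hardy, constant `4 · ¼ = 1`). [folklore] -/
theorem integral_stretching_le_integral_frobeniusNormSq (hV : IsTypeIAncientMild M V)
    {C₁ C₂ : ℝ}
    (hD1 : ∀ t < 0, ∀ x, (‖x‖ + Real.sqrt (-t)) ^ (1 + 1) * ‖iteratedFDeriv ℝ 1 (V t) x‖ ≤ C₁)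
    (hD2 : ∀ t < 0, ∀ x, (‖x‖ + Real.sqrt (-t)) ^ (2 + 1) * ‖iteratedFDeriv ℝ 2 (V t) x‖ ≤ C₂)
    (s : ℝ) {y₀ : EuclideanSpace ℝ (Fin 3)}
    (hthr : ∀ y, ⟪lerayVorticity V s y, fderiv ℝ (lerayOrbit V s) y (lerayVorticity V s y)⟫ *
      ‖y - y₀‖ ^ 2 ≤ (1 / 4) * ‖lerayVorticity V s y‖ ^ 2) :
    ∫ y, ⟪lerayVorticity V s y, fderiv ℝ (lerayOrbit V s) y (lerayVorticity V s y)⟫ ≤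
      ∫ y, frobeniusNormSq (fderiv ℝ (lerayVorticity V s) y) := by
  have hΩ := contDiff_lerayVorticity_slice hV s
  have hΩ1 : ContDiff ℝ 1 (lerayVorticity V s) := hΩ.of_le (by norm_cast)
  have iF := integrable_frobeniusNormSq_fderiv_lerayVorticity hV hD2 s
  -- decay of `Ω(s)` about the centre `y₀`
  have hc₀ := decayConst_nonneg hD1
  have hdec : ∀ y : EuclideanSpace ℝ (Fin 3), 1 < ‖y - y₀‖ →
      ‖y - y₀‖ * ‖lerayVorticity V s y‖ ≤ ‖curlCLM‖ * C₁ * (1 + ‖y₀‖) := by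
    intro y _
    have h := norm_lerayVorticity_le_decay hV hD1 s y
    have hy : ‖y - y₀‖ ≤ (1 + ‖y‖) * (1 + ‖y₀‖) := by
      have := norm_sub_le y y₀; nlinarith [norm_nonneg y, norm_nonneg y₀]
    have hpow : (1 + ‖y‖) ^ (-(2 : ℝ)) ≤ (1 + ‖y‖)⁻¹ := by
      have := SlabLaw.rpow_neg_le_rpow_neg_of_le y (show (1 : ℝ) ≤ 2 by norm_num)
      rwa [Real.rpow_neg_one] at this
    calc ‖y - y₀‖ * ‖lerayVorticity V s y‖
        ≤ ((1 + ‖y‖) * (1 + ‖y₀‖)) * (‖curlCLM‖ * C₁ * (1 + ‖y‖) ^ (-(2 : ℝ))) :=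
          mul_le_mul hy h (norm_nonneg _) (by positivity)
      _ ≤ ((1 + ‖y‖) * (1 + ‖y₀‖)) * (‖curlCLM‖ * C₁ * (1 + ‖y‖)⁻¹) := by
          gcongr
      _ = ‖curlCLM‖ * C₁ * (1 + ‖y₀‖) := by field_simp
  -- Hardy: `∫⁻ |Ω|²/|y−y₀|² ≤ 4 ∫⁻ |∇Ω|²_F`
  have hH := hardy_sq_lintegral_sub_le_of_decay_vec hΩ1 y₀ one_pos hdec
  have hsum : ∑ i, ∫⁻ y, ENNReal.ofReal (‖fderiv ℝ (fun z => lerayVorticity V s z i) y‖ ^ 2) =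
      ∫⁻ y, ENNReal.ofReal (frobeniusNormSq (fderiv ℝ (lerayVorticity V s) y)) := by
    rw [← lintegral_finsetSum _ fun i _ => ?_]
    · refine lintegral_congr fun y => ?_
      rw [frobeniusNormSq_fderiv_eq_sum_norm_fderiv_coord_sq ((hΩ1.differentiable one_ne_zero) y),
        ENNReal.ofReal_sum_of_nonneg fun i _ => sq_nonneg _]
    · exact ((((contDiff_euclidean.1 hΩ1 i).continuous_fderiv one_ne_zero).norm).pow
        2).measurable.ennreal_ofReal
  have hFlin : ∫⁻ y, ENNReal.ofReal (frobeniusNormSq (fderiv ℝ (lerayVorticity V s) y)) =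
      ENNReal.ofReal (∫ y, frobeniusNormSq (fderiv ℝ (lerayVorticity V s) y)) :=
    (ofReal_integral_eq_lintegral_ofReal iF
      (Eventually.of_forall fun y => frobeniusNormSq_nonneg _)).symm
  rw [hsum, hFlin] at hH
  -- the majorant `h = |Ω|²/|y−y₀|²` is integrable
  set h : EuclideanSpace ℝ (Fin 3) → ℝ := fun y => ‖lerayVorticity V s y‖ ^ 2 / ‖y - y₀‖ ^ 2 with hh
  have hmeas : AEStronglyMeasurable h volume :=
    ((hΩ.continuous.norm.pow 2).measurable.div
      ((continuous_norm.comp (continuous_id.sub continuous_const)).pow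
        2).measurable).aestronglyMeasurable
  have hnn : 0 ≤ᵐ[volume] h := Eventually.of_forall fun y => by positivity
  have hfin : ∫⁻ y, ENNReal.ofReal (h y) < (⊤ : ℝ≥0∞) :=
    lt_of_le_of_lt hH (ENNReal.mul_lt_top (by norm_num) ENNReal.ofReal_lt_top)
  have hint : Integrable h := by
    refine ⟨hmeas, ?_⟩
    rw [hasFiniteIntegral_iff_norm]
    refine lt_of_le_of_lt (le_of_eq ?_) hfin
    refine lintegral_congr fun y => ?_
    rw [Real.norm_of_nonneg (by positivity)]
  have hle : ∫ y, h y ≤ 4 * ∫ y, frobeniusNormSq (fderiv ℝ (lerayVorticity V s) y) := by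
    have e1 : ENNReal.ofReal (∫ y, h y) ≤
        4 * ENNReal.ofReal (∫ y, frobeniusNormSq (fderiv ℝ (lerayVorticity V s) y)) := by
      rw [ofReal_integral_eq_lintegral_ofReal hint hnn]; exact hH
    have hFnn : 0 ≤ ∫ y, frobeniusNormSq (fderiv ℝ (lerayVorticity V s) y) :=
      integral_nonneg fun y => frobeniusNormSq_nonneg _
    rw [show (4 : ℝ≥0∞) = ENNReal.ofReal 4 by norm_num, ← ENNReal.ofReal_mul (by norm_num)] at e1
    exact (ENNReal.ofReal_le_ofReal_iff (by positivity)).1 e1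
  -- pointwise (a.e.): stretching ≤ ¼ h
  have hae : ∀ᵐ y ∂volume,
      ⟪lerayVorticity V s y, fderiv ℝ (lerayOrbit V s) y (lerayVorticity V s y)⟫ ≤
        (1 / 4) * h y := by
    have hy₀ : ∀ᵐ y ∂(volume : Measure (EuclideanSpace ℝ (Fin 3))), y ≠ y₀ := by
      have : (volume : Measure (EuclideanSpace ℝ (Fin 3))) {y₀} = 0 := measure_singleton y₀
      refine ae_iff.2 ?_
      simp only [ne_eq, not_not, setOf_eq_eq_singleton]
      exact this
    filter_upwards [hy₀] with y hy
    have hpos : 0 < ‖y - y₀‖ ^ 2 := by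
      have : 0 < ‖y - y₀‖ := norm_pos_iff.2 (sub_ne_zero.2 hy)
      positivity
    rw [hh]
    have := hthr y
    rw [show (1 / 4 : ℝ) * (‖lerayVorticity V s y‖ ^ 2 / ‖y - y₀‖ ^ 2) =
      ((1 / 4) * ‖lerayVorticity V s y‖ ^ 2) / ‖y - y₀‖ ^ 2 by ring, le_div_iff₀ hpos]
    exact this
  calc ∫ y, ⟪lerayVorticity V s y, fderiv ℝ (lerayOrbit V s) y (lerayVorticity V s y)⟫
      ≤ ∫ y, (1 / 4) * h y :=
        integral_mono_ae (integrable_inner_stretching_lerayVorticity hV hD1 s) (hint.const_mul _)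
          hae
    _ = (1 / 4) * ∫ y, h y := integral_const_mul _ _
    _ ≤ (1 / 4) * (4 * ∫ y, frobeniusNormSq (fderiv ℝ (lerayVorticity V s) y)) := by gcongr
    _ = ∫ y, frobeniusNormSq (fderiv ℝ (lerayVorticity V s) y) := by ring

/-- **T38 core (similarity level, CLASSICAL): a Hardy-subcritical stretching bound along the vorticity
forces triviality.** Let `V` be a KNSS-gauge Type-I field with the decay hypothesis (D) at orders
`1, 2, 3`. If for every `s` there is a centre `y₀(s)` with
`⟪Ω, DU Ω⟫(s,y) · ‖y − y₀(s)‖² ≤ ¼ ‖Ω(s,y)‖²` for all `y` (the similarity form of the physical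
threshold `‖x − x₀‖² ⟪ξ, ∇u ξ⟫ ≤ ¼` on `{ω ≠ 0}`, `y₀(s) = e^{s/2} x₀`), then `V ≡ 0` on `t < 0`:
Hardy gives `Str ≤ ∫|∇Ω|²_F`, the enstrophy identity gives `Z' ≤ −½ Z`, `Z` is bounded by (D), so
`Z ≡ 0` by the backward ODE lemma; hence `curl U ≡ 0`, and a curl-free, divergence-free Type-I field
vanishes. [this file; theory T38-SCOPE (S4) core; EXPLICIT-THRESHOLDS T38 (DERIVED)] -/
theorem eq_zero_of_hardySubcriticalStretching (hV : IsTypeIAncientMild M V) {C₁ C₂ C₃ : ℝ}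
    (hD1 : ∀ t < 0, ∀ x, (‖x‖ + Real.sqrt (-t)) ^ (1 + 1) * ‖iteratedFDeriv ℝ 1 (V t) x‖ ≤ C₁)
    (hD2 : ∀ t < 0, ∀ x, (‖x‖ + Real.sqrt (-t)) ^ (2 + 1) * ‖iteratedFDeriv ℝ 2 (V t) x‖ ≤ C₂)
    (hD3 : ∀ t < 0, ∀ x, (‖x‖ + Real.sqrt (-t)) ^ (3 + 1) * ‖iteratedFDeriv ℝ 3 (V t) x‖ ≤ C₃)
    (hthr : ∀ s : ℝ, ∃ y₀ : EuclideanSpace ℝ (Fin 3), ∀ y,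
      ⟪lerayVorticity V s y, fderiv ℝ (lerayOrbit V s) y (lerayVorticity V s y)⟫ * ‖y - y₀‖ ^ 2 ≤
        (1 / 4) * ‖lerayVorticity V s y‖ ^ 2) :
    ∀ t < 0, ∀ x, V t x = 0 := by
  set Z : ℝ → ℝ := fun σ => ∫ y, ‖lerayVorticity V σ y‖ ^ 2 with hZ
  have hZd := fun σ => similarityEnstrophy_hasDerivAt hV hD1 hD2 hD3 σ
  have hdiff : Differentiable ℝ Z := fun σ => (hZd σ).differentiableAt
  have hZ0 : ∀ σ, 0 ≤ Z σ := fun σ => integral_nonneg fun y => by positivity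
  -- `Z` bounded
  have hc₀ := decayConst_nonneg hD1
  have hcont : Continuous fun y : EuclideanSpace ℝ (Fin 3) =>
      (‖curlCLM‖ * C₁) ^ 2 * (1 + ‖y‖) ^ (-(4 : ℝ)) :=
    continuous_const.mul ((continuous_const.add continuous_norm).rpow_const
      fun y => Or.inl (add_pos_of_pos_of_nonneg one_pos (norm_nonneg y)).ne')
  have imaj : Integrable fun y : EuclideanSpace ℝ (Fin 3) =>
      (‖curlCLM‖ * C₁) ^ 2 * (1 + ‖y‖) ^ (-(4 : ℝ)) :=
    integrable_of_le_decay_four hcont (K := (‖curlCLM‖ * C₁) ^ 2) fun y => by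
      rw [Real.norm_of_nonneg (by positivity)]
  have hbdd : ∃ B, ∀ σ, Z σ ≤ B := by
    refine ⟨∫ y : EuclideanSpace ℝ (Fin 3), (‖curlCLM‖ * C₁) ^ 2 * (1 + ‖y‖) ^ (-(4 : ℝ)),
      fun σ => ?_⟩
    refine integral_mono (integrable_norm_lerayVorticity_sq hV hD1 σ) imaj fun y => ?_
    have h := norm_lerayVorticity_le_decay hV hD1 σ y
    calc ‖lerayVorticity V σ y‖ ^ 2 ≤ (‖curlCLM‖ * C₁ * (1 + ‖y‖) ^ (-(2 : ℝ))) ^ 2 :=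
          pow_le_pow_left₀ (norm_nonneg _) h 2
      _ = (‖curlCLM‖ * C₁) ^ 2 * ((1 + ‖y‖) ^ (-(2 : ℝ)) * (1 + ‖y‖) ^ (-(2 : ℝ))) := by ring
      _ = (‖curlCLM‖ * C₁) ^ 2 * (1 + ‖y‖) ^ (-(4 : ℝ)) := by
          rw [SlabLaw.rpow_neg_mul_rpow_neg]; norm_num
  -- `Z' ≤ −½ Z`
  have hZ' : ∀ σ, deriv Z σ ≤ -(1 / 2) * Z σ := by
    intro σ
    rw [(hZd σ).deriv]
    obtain ⟨y₀, hy₀⟩ := hthr σ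
    have hS := integral_stretching_le_integral_frobeniusNormSq hV hD1 hD2 σ hy₀
    have hZσ : Z σ = ∫ y, ‖lerayVorticity V σ y‖ ^ 2 := rfl
    rw [hZσ]
    linarith
  have hZzero := eq_zero_of_deriv_le_neg_half_mul hdiff hZ0 hbdd hZ'
  -- `Ω ≡ 0`
  have hΩ0 : ∀ s y, lerayVorticity V s y = 0 := by
    intro s y
    have hc := (contDiff_lerayVorticity_slice hV s).continuous
    have hint := integrable_norm_lerayVorticity_sq hV hD1 s
    have hae : (fun y => ‖lerayVorticity V s y‖ ^ 2) =ᵐ[volume] 0 :=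
      (integral_eq_zero_iff_of_nonneg (fun y => by positivity) hint).1 (hZzero s)
    have hev : (fun y => ‖lerayVorticity V s y‖ ^ 2) = fun _ => (0 : ℝ) :=
      ((hc.norm.pow 2).ae_eq_iff_eq (μ := volume) continuous_const).1 hae
    have := congrFun hev y
    simpa using this
  -- back to physical variables (as in `GaussianGap.typeI_ancient_gaussianGap_eq_zero`)
  have hcurl : ∀ t < 0, ∀ x, curl (V t) x = 0 := by
    intro t ht x
    set s : ℝ := -Real.log (-t) with hs
    have hts : -Real.exp (-s) = t := by
      rw [hs, neg_neg, Real.exp_log (neg_pos.2 ht), neg_neg]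
    have h := hΩ0 s ((Real.exp (-s / 2))⁻¹ • x)
    rw [lerayVorticity_apply, curl_lerayOrbit, smul_smul,
      mul_inv_cancel₀ (Real.exp_pos _).ne', one_smul, hts, smul_eq_zero] at h
    exact h.resolve_left (Real.exp_pos _).ne'
  have hconst : ∀ t < 0, ∀ x, V t x = V t 0 := fun t ht x =>
    eq_of_curl_eq_zero_of_isDivFree_of_bounded ((hV.contDiff_slice ht).of_le (by norm_cast))
      (hcurl t ht) (hV.isDivFree ht) (fun z => hV.norm_le ht z) x 0
  exact fun t ht x => hV.eq_zero_of_slice_const (b := fun t => V t 0) hconst ht x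

end Summit.NavierStokesRegularity.NavierStokesRegularity.Theorems.SimilarityEnstrophy
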